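import Summits.BirchSwinnertonDyer.BirchSwinnertonDyer.Theorems.ClassRecordThreeEulerHalvesAtThreeShimuraAuxNormE0Prime
import HarnessLib

/-!
# Gross's E′-LABEL at a K-split carrier from the BARE norm relation (B4), two LOCAL E₀-inputs and an auxiliary inert level —
# the family-generic form of `ShimuraWalk.labelE0Prime_at_carrier_of_galTrivial_of_kills_of_auxLevel` (tam3-p1 g18, p641143)
# Cell `bsd-stepL`, seat `bsd-line-er5-p1-w5` g0 (width seat on crux 19715 `EulerHalfNotRamNoInertSetAtFive`, line `birth`);
# `--supports stmt-BirchSwinnertonDyer-19715 --as helper` (route-free; generic prime `p`, generic carrier `q`, generic family `ys`)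

WHY. bsd-idea-9's auxiliary-norm lever («an auxiliary norm kills the component», `Lines/aux_norm_receptacle.lean` v4–v6) was
kernel-checked by tam3-p1 g18 as `ShimuraWalk.labelE0Prime_at_carrier_of_galTrivial_of_kills_of_auxLevel` for a CM family `ys`
carrying the WHOLE printed label package `ShimuraWalk.LabelsAt W N K ι y ys ε` of the carrier-inert Shimura road — of which the proof
uses exactly ONE conjunct, (B4) = Gross's norm relation `∑_{i ≤ ℓ} σ^i ys(m) = a_ℓ • ys(m/ℓ)` at square-free levels on inert good
primes. THIS FILE re-runs that proof with (B4) as a BARE hypothesis `hB4` (its text VERBATIM the fifth conjunct of `LabelsAt`), so that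
the lever applies to ANY family with the norm relation — in particular to the X₀(N) Kolyvagin–Heegner family
`y(m) = φ(x(m)) ∈ E(K[m])` (`heegnerPointComplexOfConductor`), for which (B4) is a KERNEL THEOREM at every inert good level
(`finsum_mem_ringClassGalOver_eq_frobeniusTrace_smul`, `HeegnerTraceRelationProofs`; no Kolyvagin ∕ surjectivity ∕ CM hypothesis) —
the road by which the S1b branch of crux 19715 can feed its `hGZ` receptacle binder WITHOUT [GZ86 III (3.1)]
(`Gross1991_heegnerPoint_sub_ratTorsion_mem_E0_imageFree`, conjunct 2 of item 27981 `EulerHalfGrossPrintFacts`).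

WHAT. `labelE0Prime_at_carrier_of_trace_of_galTrivial_of_kills_of_auxLevel`: `K` imaginary quadratic with its ring class tower
`K[·] ⊂ ℂ`, a prime `p`, a prime `q ∣ N`, `c ≠ 0` (intended `c_q(E/ℚ_q)`), a family `ys : (m : ℕ) → E(K[m])`, and the HYPOTHESES
(B4) `hB4` (norm relation at every square-free level with inert good prime factors), (T) `hT` (every `τ ∈ Aut_ℚ(K[n])` fixing a place
`w ∋ q` acts trivially on `E(K[n]) ∕ E₀,w`), (C) `hC` (`c` kills `E(K[n]) ∕ E₀,w`), (AUX) `hAux` (VERBATIM the body of bsd-idea-9's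
`AuxiliaryInertLevel W K ι p q N`) ⟹ ONE `n' = c ∕ p^{ord_p c}`, prime to `p`, with `n' • ys m ∈ E₀(K[m])_w` at every guarded level
`m` and every `w ∋ q` — conclusion VERBATIM that of p641143's theorem. PROOF: p641143's, symbol for symbol, with `hLab.2.2.2.2.1`
replaced by `hB4` ((A1″) orbit counting `exists_sum_range_eq_card_stabilizer_nsmul_of_invariant`, (A2) Bezout
`nsmul_ordCompl_eq_zero_of_smul_eq_card_nsmul`, the descent `hasNonsingularReduction_of_forall_place_map` — all of `…ShimuraE0Descent`).
(Sanity, not re-landed — the gate's dedup forbids restating p641143: its statement is this theorem at `hB4 := hLab.2.2.2.2.1`, checked in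
the seat's combined file.)
-- adapted from Summits/BirchSwinnertonDyer/BirchSwinnertonDyer/Theorems/ClassRecordThreeEulerHalvesAtThreeShimuraAuxNormE0Prime.lean
-- (tam3-p1 g18, p641143) — itself adapted from Cruxes/EulerHalfNotRamNoInertSetAtFive/Lines/aux_norm_receptacle.lean §2 (bsd-idea-9 g8).

HONEST FRAMING: THEOREMS ONLY (no definition, no named fact, no instance, no `sorry`); (B4), (T), (C), (AUX) are HYPOTHESES; nothing is
asserted about any CM point; no stub ∕ item closes; 19715 is not closed by this; BSD is proved for no curve (T7); no summit statement is
touched. References (locators only): [cite: GrossLMS1991, §3 Prop. 3.7 (1) (p. 239), §6 proof of Prop. 6.2 (1) (p. 245 «E′»)]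
[cite: SilvermanATAEC1994, IV Cor. 9.2 (d), IV §9] [cite: SilvermanAEC2009, VII Prop. 2.1].
presearch: «auxiliary prime norm relation kills component group Heegner point» → none as a lemma (tam3-p1 g18's line for p641143,
corpus fts+vec + galaxy); nearest [corpus:GrossLMS1991 p.245] «E′» (currency); mechanism = bsd-idea-9's card `aux-norm-receptacle`.
Axioms: `propext`, `Classical.choice`, `Quot.sound`.
-/

set_option autoImplicit false
set_option linter.dupNamespace false

noncomputable section

open scoped Classical NumberField Pointwise

namespace Summit.BirchSwinnertonDyer.BirchSwinnertonDyer.Theorems.ShimuraWalk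

open WeierstrassCurve IsDedekindDomain NumberField Field Literature.NumberTheory.EllipticCurves

/-! ### The E′-label at a carrier from the bare (B4), (T), (C) and an auxiliary inert level -/

section Composition

variable (W : WeierstrassCurve ℚ) [W.IsElliptic] [W.IsGloballyMinimal] {K : Type} [Field K] [NumberField K]
  (ι : K →+* ℂ)

omit [W.IsElliptic] in
set_option maxHeartbeats 1600000 in
/-- **The E′-label at a K-split carrier `q` from the BARE norm relation (B4), the two local E₀-inputs (T), (C) and an auxiliary
inert level.** `K` imaginary quadratic with its ring class tower `K[·] ⊂ ℂ`, a prime `p`, a prime `q ∣ N`, a natural number `c ≠ 0`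
(intended `c_q(E/ℚ_q)`), ANY family `ys : (m : ℕ) → E(K[m])`, and the four HYPOTHESES
(B4) `hB4`: VERBATIM the fifth conjunct of `ShimuraWalk.LabelsAt W N K ι y ys ε` — at every square-free level `m` with inert good prime
factors, every `ℓ ∣ m` and every generator `σ` of `Gal(K[m]/K[m/ℓ])`: `∑_{i ≤ ℓ} σ^i ys(m) = a_ℓ • ys(m/ℓ)` read in `E(K[m])`;
(T) `hT`: at every level `n ≠ 0`, `q ∤ n`, every place `w ∋ q` of `K[n]` and every `τ ∈ Aut_ℚ(K[n])` with `τ • w = w`: `τ P − P ∈ E₀(K[n])_w`;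
(C) `hC`: there, `c • P ∈ E₀(K[n])_w` for every `P`;
(AUX) `hAux`: VERBATIM the body of bsd-idea-9's `AuxiliaryInertLevel W K ι p q N`.
THEN there is ONE `n'` prime to `p` (namely `c ∕ p^{ord_p c}`) with `n' • ys m ∈ E₀(K[m])_w` at every guarded level `m` and every place
`w ∋ q` — VERBATIM the conclusion of `labelE0Prime_at_carrier_of_galTrivial_of_kills_of_auxLevel` (p641143).
[cite: GrossLMS1991, §3 Prop. 3.7 (1), §6 p. 245] [cite: SilvermanATAEC1994, IV Cor. 9.2 (d)] -/
theorem labelE0Prime_at_carrier_of_trace_of_galTrivial_of_kills_of_auxLevel [∀ j : ℕ, NumberField (ringClassField K ι j)]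
    (hK : IsImaginaryQuadratic K) {p : ℕ} [Fact p.Prime] {q : ℕ} [Fact q.Prime] {N : ℕ} (hqN : q ∣ N)
    {c : ℕ} (hc0 : c ≠ 0)
    (ys : (m : ℕ) → (W.baseChange (ringClassField K ι m)).toAffine.Point)
    (hB4 : ∀ m : ℕ, Squarefree m →
      (∀ r ∈ m.primeFactors, ¬ r ∣ N ∧ (Ideal.span {(r : 𝓞 K)}).IsPrime) →
      ∀ (ℓ : ℕ) (_ : ℓ ∈ m.primeFactors) (hle : ringClassField K ι (m / ℓ) ≤ ringClassField K ι m)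
        (σ : ringClassField K ι m ≃ₐ[ℚ] ringClassField K ι m),
        Subgroup.zpowers σ = ringClassGalOver ι m (m / ℓ) →
        letI : Algebra K ℂ := ι.toAlgebra
        ∑ i ∈ Finset.range (ℓ + 1), pointGalHom W (ringClassField K ι m) (σ ^ i) (ys m) =
          W.frobeniusTrace ℓ • WeierstrassCurve.Affine.Point.map (W' := W)
            ((RingClassField.inclusion ι hle).restrictScalars ℚ) (ys (m / ℓ)))
    (hT : ∀ n : ℕ, n ≠ 0 → ¬ q ∣ n → ∀ (w : HeightOneSpectrum (𝓞 (ringClassField K ι n))),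
      ((q : ℕ) : 𝓞 (ringClassField K ι n)) ∈ w.asIdeal →
      ∀ τ : ringClassField K ι n ≃ₐ[ℚ] ringClassField K ι n, τ • w.asIdeal = w.asIdeal →
      ∀ P : (W.baseChange (ringClassField K ι n)).toAffine.Point,
        (placeIntModel W (ringClassField K ι n) w).HasNonsingularReduction (K := ringClassField K ι n)
          (pointGalHom W (ringClassField K ι n) τ P - P))
    (hC : ∀ n : ℕ, n ≠ 0 → ¬ q ∣ n → ∀ (w : HeightOneSpectrum (𝓞 (ringClassField K ι n))),
      ((q : ℕ) : 𝓞 (ringClassField K ι n)) ∈ w.asIdeal →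
      ∀ P : (W.baseChange (ringClassField K ι n)).toAffine.Point,
        (placeIntModel W (ringClassField K ι n) w).HasNonsingularReduction (K := ringClassField K ι n) (c • P))
    (hAux : ∀ e m₀ : ℕ, Squarefree m₀ → (∀ r ∈ m₀.primeFactors, ¬ r ∣ N ∧ (Ideal.span {(r : 𝓞 K)}).IsPrime) →
      ∃ ℓ₀ : ℕ, ℓ₀.Prime ∧ ¬ ℓ₀ ∣ N ∧ ¬ ℓ₀ ∣ m₀ ∧ (Ideal.span {(ℓ₀ : 𝓞 K)}).IsPrime ∧
        ¬ (p : ℤ) ∣ W.frobeniusTrace ℓ₀ ∧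
        ∀ σ : ringClassField K ι (ℓ₀ * m₀) ≃ₐ[ℚ] ringClassField K ι (ℓ₀ * m₀),
          Subgroup.zpowers σ = ringClassGalOver ι (ℓ₀ * m₀) m₀ →
          σ ^ (ℓ₀ + 1) = 1 ∧
          ∀ w : HeightOneSpectrum (𝓞 (ringClassField K ι (ℓ₀ * m₀))),
            ((q : ℕ) : 𝓞 (ringClassField K ι (ℓ₀ * m₀))) ∈ w.asIdeal →
            p ^ e ∣ Nat.card (MulAction.stabilizer (Subgroup.zpowers σ) w.asIdeal)) :
    ∃ n' : ℕ, ¬ p ∣ n' ∧ ∀ m : ℕ, Squarefree m → (∀ r ∈ m.primeFactors, ¬ r ∣ N ∧ (Ideal.span {(r : 𝓞 K)}).IsPrime) →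
      ∀ [NumberField (ringClassField K ι m)] (w : HeightOneSpectrum (𝓞 (ringClassField K ι m))),
        ((q : ℕ) : 𝓞 (ringClassField K ι m)) ∈ w.asIdeal →
        (placeIntModel W (ringClassField K ι m) w).HasNonsingularReduction (K := ringClassField K ι m) (n' • ys m) := by
  have hp : p.Prime := Fact.out
  have hq : q.Prime := Fact.out
  set e : ℕ := c.factorization p with he
  have hpe : p ^ e ∣ c := Nat.ordProj_dvd _ _
  refine ⟨c / p ^ e, Nat.not_dvd_ordCompl hp hc0, fun m₀ hm₀ hg₀ _ w₀ hw₀ ↦ ?_⟩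
  -- the auxiliary level `ℓ₀ m₀`
  obtain ⟨ℓ₀, hℓ₀, hℓ₀N, hℓ₀m, hℓ₀P, haℓ, hgrp⟩ := hAux e m₀ hm₀ hg₀
  have hm0 : m₀ ≠ 0 := hm₀.ne_zero
  have hM0 : ℓ₀ * m₀ ≠ 0 := mul_ne_zero hℓ₀.ne_zero hm0
  have hqm : ¬ q ∣ m₀ := fun h ↦ (hg₀ q (Nat.mem_primeFactors.mpr ⟨hq, h, hm0⟩)).1 hqN
  have hqℓ : q ≠ ℓ₀ := fun h ↦ hℓ₀N (h ▸ hqN)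
  have hqM : ¬ q ∣ ℓ₀ * m₀ := fun h ↦ ((Nat.Prime.dvd_mul hq).mp h).elim
    (fun h1 ↦ hqℓ ((Nat.prime_dvd_prime_iff_eq hq hℓ₀).mp h1)) hqm
  have hsqM : Squarefree (ℓ₀ * m₀) :=
    (Nat.squarefree_mul ((Nat.Prime.coprime_iff_not_dvd hℓ₀).mpr hℓ₀m)).mpr ⟨hℓ₀.prime.squarefree, hm₀⟩
  have hgM : ∀ r ∈ (ℓ₀ * m₀).primeFactors, ¬ r ∣ N ∧ (Ideal.span {(r : 𝓞 K)}).IsPrime := by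
    intro r hr
    rw [Nat.primeFactors_mul hℓ₀.ne_zero hm0, Finset.mem_union] at hr
    rcases hr with hr | hr
    · rw [hℓ₀.primeFactors, Finset.mem_singleton] at hr
      subst hr
      exact ⟨hℓ₀N, hℓ₀P⟩
    · exact hg₀ r hr
  have hℓmem : ℓ₀ ∈ (ℓ₀ * m₀).primeFactors := Nat.mem_primeFactors.mpr ⟨hℓ₀, dvd_mul_right _ _, hM0⟩
  -- a generator `σ` of `G_{ℓ₀}`; work at the level pair `(ℓ₀ m₀, ℓ₀ m₀ / ℓ₀)` and transport to `m₀` at the end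
  obtain ⟨σ, hσ⟩ := RingClassGalOverCyclic.exists_zpowers_eq_ringClassGalOver_mul hK ι hm0 hℓ₀ hℓ₀m hℓ₀P
  obtain ⟨hσn, hstab⟩ := hgrp σ hσ
  have hdiv : ℓ₀ * m₀ / ℓ₀ = m₀ := Nat.mul_div_cancel_left m₀ hℓ₀.pos
  have hle' : ringClassField K ι (ℓ₀ * m₀ / ℓ₀) ≤ ringClassField K ι (ℓ₀ * m₀) :=
    ringClassField_div_le hK ι (dvd_mul_right ℓ₀ m₀) hM0
  have hσ' : Subgroup.zpowers σ = ringClassGalOver ι (ℓ₀ * m₀) (ℓ₀ * m₀ / ℓ₀) := by rw [hdiv]; exact hσ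
  -- (B4) at level `ℓ₀ m₀` with `ℓ = ℓ₀` — the ONE change vs p641143: the bare hypothesis instead of `hLab.2.2.2.2.1`
  have h4 := hB4 (ℓ₀ * m₀) hsqM hgM ℓ₀ hℓmem hle' σ hσ'
  obtain ⟨f, h4f, -⟩ : ∃ f : ringClassField K ι (ℓ₀ * m₀ / ℓ₀) →ₐ[ℚ] ringClassField K ι (ℓ₀ * m₀),
      _ = W.frobeniusTrace ℓ₀ • WeierstrassCurve.Affine.Point.map (W' := W) f (ys (ℓ₀ * m₀ / ℓ₀)) ∧
      (∀ x : ringClassField K ι (ℓ₀ * m₀ / ℓ₀), ((f x : ringClassField K ι (ℓ₀ * m₀)) : ℂ) = (x : ℂ)) :=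
    ⟨_, h4, fun x ↦ RingClassField.coe_inclusion ι hle' x⟩
  -- the E′-label at level `ℓ₀ m₀ / ℓ₀`, read at level `ℓ₀ m₀` at every place `w̃ ∋ q`, then descended (`hasNonsingularReduction_of_forall_place_map`)
  have hup : ∀ (wt : HeightOneSpectrum (𝓞 (ringClassField K ι (ℓ₀ * m₀)))),
      ((q : ℕ) : 𝓞 (ringClassField K ι (ℓ₀ * m₀))) ∈ wt.asIdeal →
      (placeIntModel W (ringClassField K ι (ℓ₀ * m₀)) wt).HasNonsingularReduction (K := ringClassField K ι (ℓ₀ * m₀))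
        (Affine.Point.map (W' := W) f ((c / p ^ e) • ys (ℓ₀ * m₀ / ℓ₀))) := by
    intro wt hwtq
    -- the quotient `A = E(K[ℓ₀ m₀]) ∕ E₀,w̃`
    let H : AddSubgroup (W.baseChange (ringClassField K ι (ℓ₀ * m₀))).toAffine.Point :=
      { carrier := {P | (placeIntModel W (ringClassField K ι (ℓ₀ * m₀)) wt).HasNonsingularReduction
            (K := ringClassField K ι (ℓ₀ * m₀)) P}
        zero_mem' := WeierstrassCurve.hasNonsingularReduction_zero (K := ringClassField K ι (ℓ₀ * m₀))
          (W := placeIntModel W (ringClassField K ι (ℓ₀ * m₀)) wt)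
        add_mem' := fun hP hQ ↦ MemE0ModRatTorsion.hasNonsingularReduction_placeIntModel_add hP hQ
        neg_mem' := fun hP ↦ MemE0ModRatTorsion.hasNonsingularReduction_placeIntModel_neg hP }
    set mk : (W.baseChange (ringClassField K ι (ℓ₀ * m₀))).toAffine.Point →+
        (W.baseChange (ringClassField K ι (ℓ₀ * m₀))).toAffine.Point ⧸ H := QuotientAddGroup.mk' H with hmk
    have hmem : ∀ P : (W.baseChange (ringClassField K ι (ℓ₀ * m₀))).toAffine.Point, mk P = 0 ↔
        (placeIntModel W (ringClassField K ι (ℓ₀ * m₀)) wt).HasNonsingularReduction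
          (K := ringClassField K ι (ℓ₀ * m₀)) P := by
      intro P
      rw [hmk, QuotientAddGroup.mk'_apply, QuotientAddGroup.eq_zero_iff]
      rfl
    -- (B4) read in `A`
    have key := congrArg mk h4f
    rw [map_sum, map_zsmul] at key
    -- orbit counting ((A1″) of `…ShimuraE0Descent`) with the stabiliser-invariance from (T)
    obtain ⟨t, ht⟩ := exists_sum_range_eq_card_stabilizer_nsmul_of_invariant σ hσn wt.asIdeal
      (fun g ↦ mk (pointGalHom W (ringClassField K ι (ℓ₀ * m₀)) g (ys (ℓ₀ * m₀)))) (fun g d _ hd ↦ by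
        rw [map_mul]
        change mk (pointGalHom W (ringClassField K ι (ℓ₀ * m₀)) d
          (pointGalHom W (ringClassField K ι (ℓ₀ * m₀)) g (ys (ℓ₀ * m₀)))) = _
        rw [← sub_eq_zero, ← map_sub, hmem]
        exact hT (ℓ₀ * m₀) hM0 hqM wt hwtq d hd _)
    rw [ht] at key
    -- (A2): `(c / p^e) • [f (ys _)] = 0`
    have hap : IsCoprime (W.frobeniusTrace ℓ₀) (p : ℤ) :=
      ((Prime.coprime_iff_not_dvd (Nat.prime_iff_prime_int.mp hp)).mpr haℓ).symm
    have hkill : ∀ z : (W.baseChange (ringClassField K ι (ℓ₀ * m₀))).toAffine.Point ⧸ H, c • z = 0 := by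
      intro z
      induction z using QuotientAddGroup.induction_on with
      | H P =>
        change c • mk P = 0
        rw [← map_nsmul, hmem]
        exact hC (ℓ₀ * m₀) hM0 hqM wt hwtq P
    have h0 := nsmul_ordCompl_eq_zero_of_smul_eq_card_nsmul hp.ne_zero hap hpe (hstab wt hwtq) hkill key.symm
    rw [← map_nsmul, hmem, ← map_nsmul] at h0
    exact h0
  have hfin := hasNonsingularReduction_of_forall_place_map W f q ((c / p ^ e) • ys (ℓ₀ * m₀ / ℓ₀)) hup
  rw [hdiv] at hfin
  exact hfin w₀ hw₀

end Composition

end Summit.BirchSwinnertonDyer.BirchSwinnertonDyer.Theorems.ShimuraWalk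

end
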